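import Mathlib
import Summits.KontsevichZagierPeriods.KontsevichZagierPeriods.Theorems.SoloInformedParamCoinI
import HarnessLib

/-!
# Solo-informed (A390-ii): THEOREM R for ARBITRARY `KZ_ℝ` chains (kernel form, conditional on
generator definability)

File F6e.  **Real-parameter barrier, unbounded chains.** Let `r` be ANY integral representation
over `ℚ` with transcendental value.  If the four generators of `KZ_ℝ` satisfy the definability
invariant `SoloInformedDefinableRelI` (discharged move by move from KERNEL LEMMA I in the sequel),
then `[r ⊗ ℝ] − [[0,1] × [0,ℓ], 1] ∉ KZOver.relations ℝ` for every `ℓ ≥ 0`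
(`soloInformed_realParameterBarrierI`): no chain whatsoever of the four Kontsevich–Zagier moves
with real semialgebraic data connects `r` to a rectangle, although for `ℓ = value r` both have
the same value — the real-closed analogue of Conjecture 1 fails, so any proof of the conjecture
must use arithmetic of `ℚ̄` beyond first-order real-closed-field reasoning.  The proof is that of
the bounded case (`SoloInformedRealParamBarrierBdd`) with I-admissible denotations.

References: [cite: KontsevichZagier2001, §1.2]; [cite: BochnakCosteRoy1998, Prop. 2.2.4, 5.2.3].
-/

noncomputable section

open Set MeasureTheory MvPolynomial Literature.ModelTheory.ExponentialFields
  Literature.NumberTheory.Transcendental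

namespace Summit.KontsevichZagierPeriods.KontsevichZagierPeriods.Theorems

/-- **Degenerate case of THEOREM R (arbitrary representations)**: a `ℚ`-representation with
transcendental value is not literally a rectangle `[[0,1] × [0,ℓ], 1]`.
[cite: BochnakCosteRoy1998, Prop. 5.2.3] -/
theorem soloInformed_sigma_baseChange_ne_rectI {n : ℕ} (r : KZOver.IntegralRep ℚ n)
    (hτ : Transcendental ℚ r.value) {ℓ : ℝ} (hℓ : 0 ≤ ℓ) :
    (⟨n, r.baseChange ℝ⟩ : Σ m, KZOver.IntegralRep ℝ m) ≠ ⟨2, soloInformedRealRect ℓ⟩ := by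
  intro hAB
  obtain ⟨h, hcast⟩ := (SoloInformedPTerm.sigma_mk_eq_iff _ _).1 hAB
  let cA : SoloInformedPTerm (Fin 1) 2 := (SoloInformedPTerm.const (Fin 1) r).castDim h
  let cB : SoloInformedPTerm (Fin 1) 2 := SoloInformedPTerm.rectTerm 0
  have hAadm : ∀ q, cA.SoloInformedAdmI q := fun q =>
    (SoloInformedPTerm.admI_castDim_iff h _ q).2 (SoloInformedPTerm.admI_const r q)
  have hBadm : ∀ q, cB.SoloInformedAdmI q := fun q =>
    SoloInformedPTerm.admI_of_adm (SoloInformedPTerm.adm_rectTerm q 0)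
  have hArep : ∀ q, cA.repI q = SoloInformedPTerm.castRep h (r.baseChange ℝ) := fun q => by
    rw [SoloInformedPTerm.repI_castDim, SoloInformedPTerm.repI_const r q]
  let Valid : (Fin 1 → ℝ) → Prop := fun q => 0 ≤ q 0 ∧ cA.SoloInformedCoin cB q
  have hV : IsSemialgebraic ℚ {q | Valid q} :=
    soloInformed_isSemialgebraic_setOf_and (soloInformed_isSemialgebraic_setOf_coord_nonneg 0)
      (SoloInformedPTerm.isSemialgebraic_setOf_coin cA cB)
  have hsound : ∀ q, Valid q → aeval q (X 0 : MvPolynomial (Fin 1) ℚ) = r.value := by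
    rintro q ⟨hq, hcoin⟩
    have hv := SoloInformedPTerm.valueI_eq_of_coin hcoin (hAadm q) (hBadm q)
    rw [SoloInformedPTerm.repI_rectTerm, soloInformedRealRect_value hq,
      SoloInformedPTerm.value_repI_castDim, SoloInformedPTerm.repI_const r q,
      KZOver.IntegralRep.value_baseChange] at hv
    rw [aeval_X, hv]
  refine (soloInformed_realParameter_barrier_core_fintype hV (X 0) hsound).1 hτ (fun _ => ℓ)
    ⟨hℓ, SoloInformedPTerm.coin_of_repI_eq (hAadm _) (hBadm _) ?_⟩
  rw [hArep, hcast, SoloInformedPTerm.repI_rectTerm]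

/-- **THEOREM R (arbitrary chains).** If the four generators of `KZ_ℝ` are definable, then a
`ℚ`-representation with transcendental value is not `KZ_ℝ`-equivalent to any rectangle
`[[0,1] × [0,ℓ], 1]`, `ℓ ≥ 0`. [cite: KontsevichZagier2001, §1.2, Conjecture 1] -/
theorem soloInformed_realParameterBarrierI
    (hgen : ∀ c ∈ soloInformedGenerators ℝ, SoloInformedDefinableRelI c)
    {n : ℕ} (r : KZOver.IntegralRep ℚ n) (hτ : Transcendental ℚ r.value) {ℓ : ℝ} (hℓ : 0 ≤ ℓ) :
    KZOver.of (r.baseChange ℝ) - KZOver.of (soloInformedRealRect ℓ) ∉ KZOver.relations ℝ := by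
  intro hc
  have hAB := soloInformed_sigma_baseChange_ne_rectI r hτ hℓ
  obtain ⟨K, hK, P, p₀, V, hV, hp₀, hcombo, hgood, -⟩ :=
    soloInformed_definableRelI_of_mem_relations hgen hc
  -- parameters `K ⊕ Fin 1`: the old parameters and the height of the rectangle
  let kℓ : K ⊕ Fin 1 := Sum.inr 0
  let term' : (t : P.ι) → SoloInformedPTerm (K ⊕ Fin 1) (P.dim t) :=
    fun t => (P.term t).pullback Sum.inl
  let cA : SoloInformedPTerm (K ⊕ Fin 1) n := SoloInformedPTerm.const (K ⊕ Fin 1) r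
  let cB : SoloInformedPTerm (K ⊕ Fin 1) 2 := SoloInformedPTerm.rectTerm kℓ
  have hterm_rep : ∀ t q, (term' t).repI q = (P.term t).repI (q ∘ Sum.inl) := fun t q =>
    SoloInformedPTerm.repI_pullback _ _ _
  have hterm_adm : ∀ t q, P.SoloInformedAdmI (q ∘ Sum.inl) → (term' t).SoloInformedAdmI q :=
    fun t q h => (SoloInformedPTerm.admI_pullback_iff _ _ _).2 (h t)
  have hAadm : ∀ q, cA.SoloInformedAdmI q := fun q => SoloInformedPTerm.admI_const r q
  have hBadm : ∀ q, cB.SoloInformedAdmI q := fun q =>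
    SoloInformedPTerm.admI_of_adm (SoloInformedPTerm.adm_rectTerm q kℓ)
  let Valid : (K ⊕ Fin 1 → ℝ) → Prop := fun q =>
    q ∘ Sum.inl ∈ V ∧ 0 ≤ q kℓ ∧
    (∀ t t' (h : P.dim t = P.dim t'), P.keyI p₀ t = P.keyI p₀ t' →
      ((term' t).castDim h).SoloInformedCoin (term' t') q) ∧
    (∀ t (h : P.dim t = n), P.keyI p₀ t = ⟨n, r.baseChange ℝ⟩ →
      ((term' t).castDim h).SoloInformedCoin cA q) ∧
    (∀ t (h : P.dim t = 2), P.keyI p₀ t = ⟨2, soloInformedRealRect ℓ⟩ →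
      ((term' t).castDim h).SoloInformedCoin cB q)
  -- (1) the clause set is `ℚ`-semialgebraic
  have hValid : IsSemialgebraic ℚ {q | Valid q} := by
    refine soloInformed_isSemialgebraic_setOf_and (hV.preimage_comp Sum.inl)
      (soloInformed_isSemialgebraic_setOf_and (soloInformed_isSemialgebraic_setOf_coord_nonneg kℓ)
      (soloInformed_isSemialgebraic_setOf_and ?_ (soloInformed_isSemialgebraic_setOf_and ?_ ?_)))
    · exact soloInformed_isSemialgebraic_setOf_forall fun t =>
        soloInformed_isSemialgebraic_setOf_forall fun t' =>
        soloInformed_isSemialgebraic_setOf_forall_prop fun h =>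
        soloInformed_isSemialgebraic_setOf_imp (soloInformed_isSemialgebraic_setOf_const _)
          (SoloInformedPTerm.isSemialgebraic_setOf_coin _ _)
    · exact soloInformed_isSemialgebraic_setOf_forall fun t =>
        soloInformed_isSemialgebraic_setOf_forall_prop fun h =>
        soloInformed_isSemialgebraic_setOf_imp (soloInformed_isSemialgebraic_setOf_const _)
          (SoloInformedPTerm.isSemialgebraic_setOf_coin _ _)
    · exact soloInformed_isSemialgebraic_setOf_forall fun t =>
        soloInformed_isSemialgebraic_setOf_forall_prop fun h =>
        soloInformed_isSemialgebraic_setOf_imp (soloInformed_isSemialgebraic_setOf_const _)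
          (SoloInformedPTerm.isSemialgebraic_setOf_coin _ _)
  -- (2) the original parameter satisfies the clauses
  let q₀ : K ⊕ Fin 1 → ℝ := Sum.elim p₀ fun _ => ℓ
  have hq₀inl : q₀ ∘ Sum.inl = p₀ := Sum.elim_comp_inl _ _
  have hadm₀ : P.SoloInformedAdmI (q₀ ∘ Sum.inl) := by rw [hq₀inl]; exact (hgood p₀ hp₀).1
  have hcast_rep₀ : ∀ t {m : ℕ} (h : P.dim t = m),
      ((term' t).castDim h).repI q₀ = SoloInformedPTerm.castRep h ((P.term t).repI p₀) := by
    intro t m h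
    rw [SoloInformedPTerm.repI_castDim, hterm_rep, hq₀inl]
  have hValid₀ : Valid q₀ := by
    refine ⟨by rw [hq₀inl]; exact hp₀, by simp [q₀, kℓ, hℓ], fun t t' h hk => ?_, fun t h hk => ?_,
      fun t h hk => ?_⟩
    · obtain ⟨h', hk'⟩ := (SoloInformedPTerm.sigma_mk_eq_iff _ _).1 hk
      refine SoloInformedPTerm.coin_of_repI_eq
        ((SoloInformedPTerm.admI_castDim_iff h _ _).2 (hterm_adm t _ hadm₀))
        (hterm_adm t' _ hadm₀) ?_
      rw [hcast_rep₀, hterm_rep, hq₀inl, ← hk']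
    · obtain ⟨h', hk'⟩ := (SoloInformedPTerm.sigma_mk_eq_iff _ _).1 hk
      refine SoloInformedPTerm.coin_of_repI_eq
        ((SoloInformedPTerm.admI_castDim_iff h _ _).2 (hterm_adm t _ hadm₀)) (hAadm _) ?_
      rw [hcast_rep₀, SoloInformedPTerm.repI_const r _, ← hk']
    · obtain ⟨h', hk'⟩ := (SoloInformedPTerm.sigma_mk_eq_iff _ _).1 hk
      refine SoloInformedPTerm.coin_of_repI_eq
        ((SoloInformedPTerm.admI_castDim_iff h _ _).2 (hterm_adm t _ hadm₀)) (hBadm _) ?_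
      rw [hcast_rep₀, SoloInformedPTerm.repI_rectTerm]
      exact hk'
  -- (3) on the clause set the height equals `value r`
  have hsound : ∀ q, Valid q → aeval q (X kℓ : MvPolynomial (K ⊕ Fin 1) ℚ) = r.value := by
    rintro q ⟨hqV, hqℓ, hcl, hclA, hclB⟩
    have hadm : P.SoloInformedAdmI (q ∘ Sum.inl) := (hgood _ hqV).1
    have hsum := P.sum_eq_of_comboI_eq_sub hcombo hAB
      (fun t => ((P.term t).repI (q ∘ Sum.inl)).value) r.value (q kℓ) ?_ ?_ ?_
    · rw [P.sum_valueI_eq_zero _ (hgood _ hqV).2] at hsum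
      rw [aeval_X]
      linarith
    · intro t t' hk
      have h : P.dim t = P.dim t' := congrArg Sigma.fst hk
      have hv := SoloInformedPTerm.valueI_eq_of_coin (hcl t t' h hk)
        ((SoloInformedPTerm.admI_castDim_iff h _ _).2 (hterm_adm t _ hadm)) (hterm_adm t' _ hadm)
      rwa [SoloInformedPTerm.value_repI_castDim, hterm_rep, hterm_rep] at hv
    · intro t hk
      have h : P.dim t = n := congrArg Sigma.fst hk
      have hv := SoloInformedPTerm.valueI_eq_of_coin (hclA t h hk)
        ((SoloInformedPTerm.admI_castDim_iff h _ _).2 (hterm_adm t _ hadm)) (hAadm _)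
      rwa [SoloInformedPTerm.value_repI_castDim, hterm_rep, SoloInformedPTerm.repI_const r _,
        KZOver.IntegralRep.value_baseChange] at hv
    · intro t hk
      have h : P.dim t = 2 := congrArg Sigma.fst hk
      have hv := SoloInformedPTerm.valueI_eq_of_coin (hclB t h hk)
        ((SoloInformedPTerm.admI_castDim_iff h _ _).2 (hterm_adm t _ hadm)) (hBadm _)
      rwa [SoloInformedPTerm.value_repI_castDim, hterm_rep, SoloInformedPTerm.repI_rectTerm,
        soloInformedRealRect_value hqℓ] at hv
  -- (4) a nonempty `ℚ`-semialgebraic set on which a coordinate is a transcendental constant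
  haveI : Fintype K := hK
  exact (soloInformed_realParameter_barrier_core_fintype hValid (X kℓ) hsound).1 hτ q₀ hValid₀

/-- **THEOREM R (arbitrary chains), all heights**: `r ⊗ ℝ` is not `KZ_ℝ`-equivalent to any
rectangle (for `ℓ < 0` the rectangle is empty and has value `0 ≠ value r`).
[cite: KontsevichZagier2001, §1.2, Conjecture 1] -/
theorem soloInformed_realParameterBarrierI'
    (hgen : ∀ c ∈ soloInformedGenerators ℝ, SoloInformedDefinableRelI c)
    {n : ℕ} (r : KZOver.IntegralRep ℚ n) (hτ : Transcendental ℚ r.value) (ℓ : ℝ) :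
    ¬ KZOver.Equivalent (r.baseChange ℝ) (soloInformedRealRect ℓ) := by
  intro hc
  rcases le_or_gt 0 ℓ with hℓ | hℓ
  · exact soloInformed_realParameterBarrierI hgen r hτ hℓ hc
  · have hv := hc.value_eq
    have hdom : (soloInformedRealRect ℓ).domain = ∅ := by
      ext x
      rw [soloInformed_mem_rect_domain_iff]
      simp only [mem_empty_iff_false, iff_false, not_and, not_le]
      intro _ h1
      linarith
    have h0 : (soloInformedRealRect ℓ).value = 0 := by
      rw [KZOver.IntegralRep.value, hdom, Measure.restrict_empty, integral_zero_measure]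
    rw [KZOver.IntegralRep.value_baseChange, h0] at hv
    exact hτ (hv ▸ isAlgebraic_zero)

/-- **THEOREM R for a real period with a `ℚ`-representation**, in the shape of the route's
circle-squaring barrier: under generator definability, a rectangle of transcendental height
`ℓ ≥ 0` that HAS a `ℚ`-representation of value `ℓ` (e.g. `ℓ = log 2`, `ℓ = π`) has the same value
as that representation and is nevertheless not `KZ_ℝ`-equivalent to it.
[cite: KontsevichZagier2001, §1.2, Conjecture 1] -/
theorem soloInformed_realParameterBarrierI_of_value_eq
    (hgen : ∀ c ∈ soloInformedGenerators ℝ, SoloInformedDefinableRelI c)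
    {n : ℕ} (r : KZOver.IntegralRep ℚ n) {ℓ : ℝ} (hℓ : 0 ≤ ℓ) (hv : r.value = ℓ)
    (hτ : Transcendental ℚ ℓ) :
    (r.baseChange ℝ).value = (soloInformedRealRect ℓ).value ∧
      ¬ KZOver.Equivalent (r.baseChange ℝ) (soloInformedRealRect ℓ) :=
  ⟨by rw [KZOver.IntegralRep.value_baseChange, hv, soloInformedRealRect_value hℓ],
    soloInformed_realParameterBarrierI' hgen r (hv ▸ hτ) ℓ⟩

end Summit.KontsevichZagierPeriods.KontsevichZagierPeriods.Theorems
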